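import Literature.Algebra.Homology.AttachCell
import Literature.AlgebraicGeometry.Modules.StrictlyPerfectResolution
import Literature.AlgebraicGeometry.Morphisms.CohOfVectorBundle
import Literature.AlgebraicGeometry.Modules.AffineLocalizingClosure
import Literature.AlgebraicGeometry.Modules.FiniteType
import HarnessLib

/-!
# Adapted resolutions: a bounded vector-bundle complex `K` mapping onto `H[-m]` maps, over `H[-m]`, to a vector-bundle RESOLUTION of `H[-m]`
# (Fulton B.8.3 (iii)–(v) «dominating resolutions», Hartshorne III Ex. 6.9, chain-level)

Layer `Literature/AlgebraicGeometry/KTheory` (0 named facts, no instances, no notation). On a locally noetherian scheme `X` on which every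
coherent `𝒪_X`-module admits a strictly perfect resolution — a DISPLAYED HYPOTHESIS
`hres : ∀ G, Coh G → Nonempty (StrictlyPerfectResolution G)` (on a complex abelian variety it follows from the tree's displayed fact
[SP] `ThomasonTrobaugh_vbModel_of_boundedCoh`, `Modules/StrictlyPerfectResolutionOfVBModel.nonempty_strictlyPerfectResolution_of_coh`; on a
noetherian integral separated regular scheme it is the displayed fact `Hartshorne1977_exists_strictlyPerfectResolution`) — we prove:

**`exists_adaptedResolution`**: for a bounded complex `K` of finite locally free modules concentrated in degrees `≤ m`, a coherent module `H`
and a chain map `π : K ⟶ H[-m]` which is an epimorphism in degree `m`, there are a bounded complex `P` of finite locally free modules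
concentrated in degrees `≤ m`, a QUASI-ISOMORPHISM `ε : P ⟶ H[-m]` and a CHAIN MAP `j : K ⟶ P` with `j ≫ ε = π`.

So every VB complex mapping onto `H` is dominated, OVER `H`, by a vector-bundle resolution of `H` — the chain-level tool behind «two finite
locally free resolutions of a coherent sheaf are dominated by a third» (resolution independence of `χ`, `KTheory/CoherentEulerCharacteristic`'s
displayed fact, clause 1) and behind the amplitude induction showing that `χ` ∕ `ch` of a bounded VB complex depends only on its class in
the derived category.

## Construction

Everything is built from ONE operation (`Literature/Algebra/Homology/AttachCell`, any abelian category): **attaching an object `E` in degree `a − 1` below a cochain complex `Q`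
along `ψ₀ : E → Qᵃ` with `ψ₀ ≫ dᵃ = 0`** — the mapping cone `Q⟨ψ₀⟩ := Cone(E[-a] ⟶ Q)` of the chain map from the single complex (Mathlib
`CochainComplex.mappingCone`, `HomologicalComplex.mkHomFromSingle`): its terms are `Qⁱ` for `i ≠ a − 1` and `E ⊞ Qᵃ⁻¹` in degree `a − 1`
(`isIso_inr_f`, `ιE`), its differential on `E` is `ψ₀` (`ιE_d`), maps `Q ⟶ K` killed by `ψ₀` extend (`descOfCompEqZero`), it is exact in
degree `a` as soon as `E ↠ ker dᵃ` (`exactAt_attach`, `exact_attach`), and unchanged in homology away from `a − 1, a` (`exactAt_attach_iff`,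
`quasiIsoAt_descOfCompEqZero_iff`). This file iterates it: the **K-phase** (`kInv_start`, `kInv_step`, `kInv_iter`) attaches, from degree `m − 1`
downwards, vector bundles `E ↠ ker(πᵐ)`, `E ↠ ker dᶠ` supplied by `hres` (degree-`0` terms of resolutions of the coherent kernels), making the
complex a resolution of `H[-m]` in all degrees above the frontier; once the frontier is below the support of `K`, the **T-phase** (`tInv_start`,
`tInv_step`, `tInv_iter`, `quasiIso_of_tInv`) attaches the successive terms of ONE strictly perfect resolution `T` of the last kernel, whose
exactness propagates down to the bottom, where the complex terminates. No shift functors and no cochain calculus beyond Mathlib's `mappingCone.desc`.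

Mathlib searched (pin): `CochainComplex.mappingCone` (`inl`, `inr`, `fst`, `snd`, `desc`, `inl_v_d`, `d_snd_v`, `id_X`, `isZero_X_iff`),
`ShortComplex.exact_iff_of_epi_of_isIso_of_mono`, `quasiIso_of_epi_of_isIso_of_mono`, `exact_iff_epi_kernel_lift`, `quasiIso_iff_of_zeros'`,
`quasiIsoAt_iff_comp_left`, `kernelCompMono`, `kernelIsIsoComp` (used). Research route conditional on HC_CM; not a corollary; nothing here refers
to it.

## References

* W. Fulton, *Intersection Theory*, 2nd ed. (1998), App. B.8.3 (iii)–(v) (compatible and dominating resolutions), §15.1. [Fulton1998]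
* R. Hartshorne, *Algebraic Geometry* (1977), III Ex. 6.9 (a)–(b) (p. 238–239). [Hartshorne1977]
* R. W. Thomason, T. Trobaugh, *Higher algebraic K-theory of schemes and of derived categories* (1990), 1.9.5, 2.2.x–2.3.x. [ThomasonTrobaugh1990]
* C. A. Weibel, *An introduction to homological algebra* (1994), §1.5 (mapping cones), 1.2–1.3. [Weibel1994]
-/

noncomputable section

universe u

open CategoryTheory CategoryTheory.Limits ZeroObject HomologicalComplex
open CochainComplex CochainComplex.HomComplex
namespace Literature.AlgebraicGeometry.KTheory.Adapted

open Literature.Algebra.Homology.AttachCell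

/-! ### §1 The two phases of the adapted construction -/

section Scheme

open _root_.AlgebraicGeometry Literature.AlgebraicGeometry.Modules Literature.AlgebraicGeometry.Morphisms
  Literature.AlgebraicGeometry.Motives

variable {X : Scheme.{u}}

/-- A finite locally free module is coherent. [cite: Fulton1998, App. B.8.3 (iii)–(v)] [cite: Hartshorne1977, III Ex. 6.9 (a)–(b) (p. 239)] -/
theorem coh_of_isFiniteLocallyFree {M : X.Modules} (h : IsFiniteLocallyFree M) : Coh M :=
  coh_of_isVectorBundle h.isVectorBundle

/-- The kernel of a morphism of coherent modules is coherent (`X` locally noetherian). [cite: Fulton1998, App. B.8.3 (iii)–(v)] [cite: Hartshorne1977, III Ex. 6.9 (a)–(b) (p. 239)] -/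
theorem coh_kernel [IsLocallyNoetherian X] {M N : X.Modules} (φ : M ⟶ N) (hM : Coh M) (hN : Coh N) :
    Coh (kernel φ) :=
  ⟨IsAffineLocalizing.kernel φ hM.loc hN.loc, hM.ft.kernel φ⟩

/-- The augmentation of a strictly perfect resolution of `ker g`, composed into the source of `g`, lifts back to the
augmentation: `E⁰ ↠ ker g` is `kernel.lift`. [cite: Fulton1998, App. B.8.3 (iii)–(v)] [cite: Hartshorne1977, III Ex. 6.9 (a)–(b) (p. 239)] -/
theorem epi_kernelLift_π_comp_ι {M N : X.Modules} (g : M ⟶ N) (R : StrictlyPerfectResolution (kernel g)) :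
    Epi (kernel.lift g (R.π ≫ kernel.ι g) (by rw [Category.assoc, kernel.condition, comp_zero])) := by
  have : kernel.lift g (R.π ≫ kernel.ι g) (by rw [Category.assoc, kernel.condition, comp_zero]) = R.π := by
    apply equalizer.hom_ext
    simp
  rw [this]
  exact R.epi_π

/-- `Rⁱ → R⁰ → E` composes to zero (`i + 1 = 0`; the tree's `d_comp_π` with a flexible index). [cite: Fulton1998, App. B.8.3 (iii)–(v)] [cite: Hartshorne1977, III Ex. 6.9 (a)–(b) (p. 239)] -/
theorem _root_.Literature.AlgebraicGeometry.Modules.StrictlyPerfectResolution.d_comp_π' {E : X.Modules}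
    (R : StrictlyPerfectResolution E) (i : ℤ) (hi : i + 1 = 0) : R.P.d i 0 ≫ R.π = 0 := by
  obtain rfl : i = -1 := by omega
  exact R.d_comp_π

/-- `Rⁱ ↠ ker(R⁰ → E)` (`i + 1 = 0`; exactness of the augmentation, flexible index). [cite: Fulton1998, App. B.8.3 (iii)–(v)] [cite: Hartshorne1977, III Ex. 6.9 (a)–(b) (p. 239)] -/
theorem _root_.Literature.AlgebraicGeometry.Modules.StrictlyPerfectResolution.epi_kernelLift_π {E : X.Modules}
    (R : StrictlyPerfectResolution E) (i : ℤ) (hi : i + 1 = 0) : Epi (kernel.lift R.π (R.P.d i 0) (R.d_comp_π' i hi)) := by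
  obtain rfl : i = -1 := by omega
  exact R.exact_π.epi_kernelLift

/-- A bounded complex of vector bundles vanishes below some degree. [cite: Fulton1998, App. B.8.3 (iii)–(v)] [cite: Hartshorne1977, III Ex. 6.9 (a)–(b) (p. 239)] -/
theorem _root_.Literature.AlgebraicGeometry.KTheory.IsBoundedVBComplex.exists_isZero_of_gt {K : CochainComplex X.Modules ℤ}
    (hK : IsBoundedVBComplex K) : ∃ b : ℤ, ∀ i, i < b → IsZero (K.X i) := by
  obtain ⟨s, hs⟩ := hK.exists_finset
  obtain ⟨b, hb⟩ := s.bddBelow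
  exact ⟨b, fun i hi ↦ hs i fun his ↦ (lt_irrefl _ (lt_of_lt_of_le hi (hb his)))⟩

variable [IsLocallyNoetherian X]
  (hres : ∀ G : X.Modules, Coh G → Nonempty (StrictlyPerfectResolution G))
  (K : CochainComplex X.Modules ℤ) (m : ℤ) {H : X.Modules}
  (π : K ⟶ (single X.Modules (ComplexShape.up ℤ) m).obj H)

/-- **K-phase invariant at frontier `f`**: a bounded VB complex `Q ⊇ K` (via `j`), strictly `≤ m`, with `β : Q ⟶ H[-m]` extending `π`,
a quasi-isomorphism in all degrees `> f`, and `j` an isomorphism in all degrees `< f`. [cite: Fulton1998, App. B.8.3 (iii)–(v)] [cite: Hartshorne1977, III Ex. 6.9 (a)–(b) (p. 239)] -/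
def KInv (f : ℤ) : Prop :=
  ∃ (Q : CochainComplex X.Modules ℤ) (j : K ⟶ Q) (β : Q ⟶ (single X.Modules (ComplexShape.up ℤ) m).obj H),
    IsBoundedVBComplex Q ∧ Q.IsStrictlyLE m ∧ j ≫ β = π ∧ (∀ i, f < i → QuasiIsoAt β i) ∧ (∀ i, i < f → IsIso (j.f i))

/-- **T-phase invariant** (`T` a strictly perfect resolution of the kernel at the switch point): as `KInv` at frontier `a - 1`, with all terms
below the frontier zero, and the term `Tᵗ` sitting at the frontier (`e` an isomorphism) in such a way that `Tᵗ⁻¹ → ker(dᵃ⁻¹)` is onto. [cite: Fulton1998, App. B.8.3 (iii)–(v)] [cite: Hartshorne1977, III Ex. 6.9 (a)–(b) (p. 239)] -/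
def TInv {G : X.Modules} (T : StrictlyPerfectResolution G) (t a : ℤ) : Prop :=
  ∃ (Q : CochainComplex X.Modules ℤ) (j : K ⟶ Q) (β : Q ⟶ (single X.Modules (ComplexShape.up ℤ) m).obj H),
    IsBoundedVBComplex Q ∧ Q.IsStrictlyLE m ∧ j ≫ β = π ∧ (∀ i, a - 1 < i → QuasiIsoAt β i) ∧ (∀ i, i < a - 1 → IsZero (Q.X i)) ∧
    ∃ (e : T.P.X t ⟶ Q.X (a - 1)) (he : T.P.d (t - 1) t ≫ e ≫ Q.d (a - 1) a = 0),
      IsIso e ∧ Epi (kernel.lift (Q.d (a - 1) a) (T.P.d (t - 1) t ≫ e) (by rw [Category.assoc, he]))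

variable {K m π}

section KPhase

variable (hK : IsBoundedVBComplex K) [K.IsStrictlyLE m] (hH : Coh H) (hπ : Epi (π.f m))

include hres hK hH hπ in
/-- **Start of the K-phase**: attach `E ↠ ker(πᵐ : Kᵐ → H)` in degree `m - 1`; then `Hᵐ = H`. [cite: Fulton1998, App. B.8.3 (iii)–(v)] [cite: Hartshorne1977, III Ex. 6.9 (a)–(b) (p. 239)] -/
theorem kInv_start : KInv K m π (m - 1) := by
  let eH := singleObjXSelf (ComplexShape.up ℤ) m H
  let g : K.X m ⟶ H := π.f m ≫ eH.hom
  obtain ⟨R⟩ := hres _ (coh_kernel g (coh_of_isFiniteLocallyFree (hK.isFiniteLocallyFree m)) hH)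
  let ψ₀ : R.P.X 0 ⟶ K.X m := R.π ≫ kernel.ι g
  have hψ : ψ₀ ≫ K.d m (m + 1) = 0 := (K.isZero_of_isStrictlyLE m (m + 1) (by omega)).eq_of_tgt _ _
  have hψg : ψ₀ ≫ g = 0 := by rw [Category.assoc, kernel.condition, comp_zero]
  have hψπ : ψ₀ ≫ π.f m = 0 := by
    rw [← cancel_mono eH.hom, Category.assoc, zero_comp]
    exact hψg
  have hdg : K.d (m - 1) m ≫ g = 0 := by
    rw [← Category.assoc, ← π.comm (m - 1) m, single_obj_d, comp_zero, zero_comp]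
  haveI : Epi (kernel.lift g ψ₀ hψg) := epi_kernelLift_π_comp_ι g R
  refine ⟨attach ψ₀ hψ, mappingCone.inr _, descOfCompEqZero _ π (fromSingle_comp_eq_zero_of_comp ψ₀ hψ π hψπ),
    (IsBoundedVBComplex.single (R.P.X 0) (R.isFiniteLocallyFree 0) m).mappingCone hK _,
    isStrictlyLE_attach ψ₀ hψ m (by omega), inr_descOfCompEqZero _ _ _, fun i hi ↦ ?_,
    fun i hi ↦ isIso_inr_f ψ₀ hψ i (by omega)⟩
  haveI : (attach ψ₀ hψ).IsStrictlyLE m := isStrictlyLE_attach ψ₀ hψ m (by omega)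
  rcases eq_or_lt_of_le (show m ≤ i by omega) with rfl | hlt
  · -- degree `m`: `Q⟨ψ₀⟩ᵐ⁻¹ → Kᵐ → H` exact and `Kᵐ ↠ H`
    rw [quasiIsoAt_toSingle_iff _ m ((attach ψ₀ hψ).isZero_of_isStrictlyLE m (m + 1) (by omega)) H]
    have hd : (descOfCompEqZero (fromSingle ψ₀ hψ) π (fromSingle_comp_eq_zero_of_comp ψ₀ hψ π hψπ)).f m ≫ eH.hom =
        (mappingCone.snd (fromSingle ψ₀ hψ)).v m m (add_zero m) ≫ g := by
      rw [descOfCompEqZero_f, Category.assoc]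
    refine ⟨exact_attach ψ₀ hψ (c := m - 1) (by omega) g hdg hψg hd _, ?_⟩
    rw [hd]
    haveI := isIso_snd_v_of_isZero (fromSingle ψ₀ hψ) m (isZero_single_X (a := m) (E := R.P.X 0) (m + 1) (by omega))
    haveI : Epi g := epi_comp _ _
    exact epi_comp _ _
  · -- degrees `> m`: everything vanishes
    rw [quasiIsoAt_iff_exactAt' _ i (exactAt_single_obj _ _ _ _ (by omega))]
    exact ((attach ψ₀ hψ).exactAt_iff i).2
      (ShortComplex.exact_of_isZero_X₂ _ ((attach ψ₀ hψ).isZero_of_isStrictlyLE m i hlt))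

include hres in
omit [K.IsStrictlyLE m] in
/-- **K-phase step**: from frontier `f < m` to `f - 1` — attach `E ↠ ker(dᶠ)` in degree `f - 1`. [cite: Fulton1998, App. B.8.3 (iii)–(v)] [cite: Hartshorne1977, III Ex. 6.9 (a)–(b) (p. 239)] -/
theorem kInv_step {f : ℤ} (hfm : f < m) (h : KInv K m π f) : KInv K m π (f - 1) := by
  obtain ⟨Q, j, β, hQ, hLE, hjβ, hqi, hiso⟩ := h
  obtain ⟨R⟩ := hres _ (coh_kernel (Q.d f (f + 1)) (coh_of_isFiniteLocallyFree (hQ.isFiniteLocallyFree f))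
    (coh_of_isFiniteLocallyFree (hQ.isFiniteLocallyFree (f + 1))))
  let ψ₀ : R.P.X 0 ⟶ Q.X f := R.π ≫ kernel.ι (Q.d f (f + 1))
  have hψ : ψ₀ ≫ Q.d f (f + 1) = 0 := by rw [Category.assoc, kernel.condition, comp_zero]
  haveI : Epi (kernel.lift (Q.d f (f + 1)) ψ₀ hψ) := epi_kernelLift_π_comp_ι _ R
  refine ⟨attach ψ₀ hψ, j ≫ mappingCone.inr _, descOfCompEqZero _ β (fromSingle_comp_eq_zero ψ₀ hψ β (by omega)),
    (IsBoundedVBComplex.single (R.P.X 0) (R.isFiniteLocallyFree 0) f).mappingCone hQ _,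
    isStrictlyLE_attach ψ₀ hψ m (by omega), by rw [Category.assoc, inr_descOfCompEqZero, hjβ], fun i hi ↦ ?_, fun i hi ↦ ?_⟩
  · rcases eq_or_lt_of_le (show f ≤ i by omega) with rfl | hlt
    · rw [quasiIsoAt_iff_exactAt' _ f (exactAt_single_obj _ _ _ _ (by omega))]
      exact exactAt_attach ψ₀ hψ (c := f - 1) (by omega) rfl hψ
    · exact (quasiIsoAt_descOfCompEqZero_iff _ β _ i (isZero_single_X (a := f) (E := R.P.X 0) i (by omega))
        (isZero_single_X (a := f) (E := R.P.X 0) (i + 1) (by omega))).2 (hqi i hlt)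
  · rw [comp_f]
    haveI := hiso i (by omega)
    haveI := isIso_inr_f ψ₀ hψ i (by omega)
    infer_instance

include hres hK hH hπ in
/-- **The K-phase**: frontier `m - 1 - n` for every `n`. [cite: Fulton1998, App. B.8.3 (iii)–(v)] [cite: Hartshorne1977, III Ex. 6.9 (a)–(b) (p. 239)] -/
theorem kInv_iter (n : ℕ) : KInv K m π (m - 1 - n) := by
  induction n with
  | zero => simpa using kInv_start hres hK hH hπ
  | succ n ih =>
    have e : m - 1 - ((n + 1 : ℕ) : ℤ) = m - 1 - n - 1 := by push_cast; ring
    rw [e]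
    exact kInv_step hres (by omega) ih

end KPhase

section TPhase

omit [IsLocallyNoetherian X] in
/-- **Start of the T-phase** at frontier `f < m` (all terms of `Q` below `f` being zero): attach `T⁰ ↠ G := ker(dᶠ)`, `T` a strictly
perfect resolution of `G`. [cite: Fulton1998, App. B.8.3 (iii)–(v)] [cite: Hartshorne1977, III Ex. 6.9 (a)–(b) (p. 239)] -/
theorem tInv_start {Q : CochainComplex X.Modules ℤ} (hQ : IsBoundedVBComplex Q) [Q.IsStrictlyLE m] (j : K ⟶ Q)
    (β : Q ⟶ (single X.Modules (ComplexShape.up ℤ) m).obj H) (hjβ : j ≫ β = π) {f : ℤ} (hfm : f < m)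
    (hqi : ∀ i, f < i → QuasiIsoAt β i) (hz : ∀ i, i < f → IsZero (Q.X i))
    (T : StrictlyPerfectResolution (kernel (Q.d f (f + 1)))) : TInv K m π T 0 f := by
  let ψ₀ : T.P.X 0 ⟶ Q.X f := T.π ≫ kernel.ι (Q.d f (f + 1))
  have hψ : ψ₀ ≫ Q.d f (f + 1) = 0 := by rw [Category.assoc, kernel.condition, comp_zero]
  haveI : Epi (kernel.lift (Q.d f (f + 1)) ψ₀ hψ) := epi_kernelLift_π_comp_ι _ T
  haveI hι : IsIso (ιE ψ₀ hψ (f - 1) (by omega)) := isIso_ιE ψ₀ hψ (f - 1) (by omega) (hz (f - 1) (by omega))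
  have he : T.P.d (0 - 1) 0 ≫ ιE ψ₀ hψ (f - 1) (by omega) ≫ (attach ψ₀ hψ).d (f - 1) f = 0 := by
    rw [ιE_d, ← Category.assoc, ← Category.assoc, T.d_comp_π' (0 - 1) (by norm_num), zero_comp, zero_comp]
  refine ⟨attach ψ₀ hψ, j ≫ mappingCone.inr _, descOfCompEqZero _ β (fromSingle_comp_eq_zero ψ₀ hψ β (by omega)),
    (IsBoundedVBComplex.single (T.P.X 0) (T.isFiniteLocallyFree 0) f).mappingCone hQ _,
    isStrictlyLE_attach ψ₀ hψ m (by omega), by rw [Category.assoc, inr_descOfCompEqZero, hjβ], fun i hi ↦ ?_,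
    fun i hi ↦ isZero_attach_X ψ₀ hψ i (by omega) (hz i (by omega)), ιE ψ₀ hψ (f - 1) (by omega), he, hι, ?_⟩
  · rcases eq_or_lt_of_le (show f ≤ i by omega) with rfl | hlt
    · rw [quasiIsoAt_iff_exactAt' _ f (exactAt_single_obj _ _ _ _ (by omega))]
      exact exactAt_attach ψ₀ hψ (c := f - 1) (by omega) rfl hψ
    · exact (quasiIsoAt_descOfCompEqZero_iff _ β _ i (isZero_single_X (a := f) (E := T.P.X 0) i (by omega))
        (isZero_single_X (a := f) (E := T.P.X 0) (i + 1) (by omega))).2 (hqi i hlt)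
  · -- `ker(d : Q⟨ψ₀⟩ᶠ⁻¹ → Q⟨ψ₀⟩ᶠ) ≅ ker(T⁰ → G)` is the image of `T⁻¹`
    haveI : Epi (kernel.lift T.π (T.P.d (0 - 1) 0) (T.d_comp_π' (0 - 1) (by norm_num))) := T.epi_kernelLift_π (0 - 1) (by norm_num)
    haveI : Mono (kernel.ι (Q.d f (f + 1)) ≫ (mappingCone.inr (fromSingle ψ₀ hψ)).f f) := by
      haveI := mono_inr_f (fromSingle ψ₀ hψ) f
      exact mono_comp _ _
    haveI := epi_kernelLift_of_comp_mono (T.d_comp_π' (0 - 1) (by norm_num))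
      (kernel.ι (Q.d f (f + 1)) ≫ (mappingCone.inr (fromSingle ψ₀ hψ)).f f) rfl
    exact epi_kernelLift_of_iso_comp (g := T.π ≫ kernel.ι (Q.d f (f + 1)) ≫ (mappingCone.inr (fromSingle ψ₀ hψ)).f f)
      (u := T.P.d (0 - 1) 0) _ (inv (ιE ψ₀ hψ (f - 1) _))
      (by simp only [Category.assoc, IsIso.hom_inv_id, Category.comp_id])
      (by rw [IsIso.eq_inv_comp, ιE_d, Category.assoc])

omit [IsLocallyNoetherian X] in
/-- **T-phase step** (`t ≤ 0`, frontier `a - 1 < m`): attach `Tᵗ⁻¹` in degree `a - 2`. [cite: Fulton1998, App. B.8.3 (iii)–(v)] [cite: Hartshorne1977, III Ex. 6.9 (a)–(b) (p. 239)] -/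
theorem tInv_step {G : X.Modules} (T : StrictlyPerfectResolution G) {t a : ℤ} (ht : t ≤ 0) (ham : a - 1 < m)
    (h : TInv K m π T t a) : TInv K m π T (t - 1) (a - 1) := by
  obtain ⟨Q, j, β, hQ, hLE, hjβ, hqi, hz, e, he, hiso, hE⟩ := h
  let ψ₀ : T.P.X (t - 1) ⟶ Q.X (a - 1) := T.P.d (t - 1) t ≫ e
  have hψ' : ψ₀ ≫ Q.d (a - 1) a = 0 := by rw [Category.assoc]; exact he
  have hψ : ψ₀ ≫ Q.d (a - 1) (a - 1 + 1) = 0 := by rw [sub_add_cancel]; exact hψ'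
  haveI : Epi (kernel.lift (Q.d (a - 1) a) ψ₀ hψ') := hE
  haveI hι : IsIso (ιE ψ₀ hψ (a - 1 - 1) (by omega)) := isIso_ιE ψ₀ hψ (a - 1 - 1) (by omega) (hz (a - 1 - 1) (by omega))
  have hd : ιE ψ₀ hψ (a - 1 - 1) (by omega) ≫ (attach ψ₀ hψ).d (a - 1 - 1) (a - 1) =
      T.P.d (t - 1) t ≫ e ≫ (mappingCone.inr (fromSingle ψ₀ hψ)).f (a - 1) := by
    rw [ιE_d, Category.assoc]
  have he' : T.P.d (t - 1 - 1) (t - 1) ≫ ιE ψ₀ hψ (a - 1 - 1) (by omega) ≫ (attach ψ₀ hψ).d (a - 1 - 1) (a - 1) = 0 := by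
    rw [hd, HomologicalComplex.d_comp_d_assoc, zero_comp]
  refine ⟨attach ψ₀ hψ, j ≫ mappingCone.inr _, descOfCompEqZero _ β (fromSingle_comp_eq_zero ψ₀ hψ β (by omega)),
    (IsBoundedVBComplex.single (T.P.X (t - 1)) (T.isFiniteLocallyFree (t - 1)) (a - 1)).mappingCone hQ _,
    isStrictlyLE_attach ψ₀ hψ m (by omega), by rw [Category.assoc, inr_descOfCompEqZero, hjβ], fun i hi ↦ ?_,
    fun i hi ↦ isZero_attach_X ψ₀ hψ i (by omega) (hz i (by omega)), ιE ψ₀ hψ (a - 1 - 1) (by omega), he', hι, ?_⟩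
  · rcases eq_or_lt_of_le (show a - 1 ≤ i by omega) with rfl | hlt
    · rw [quasiIsoAt_iff_exactAt' _ (a - 1) (exactAt_single_obj _ _ _ _ (by omega))]
      exact exactAt_attach ψ₀ hψ (c := a - 1 - 1) (by omega) (sub_add_cancel a 1).symm.symm hψ'
    · exact (quasiIsoAt_descOfCompEqZero_iff _ β _ i (isZero_single_X (a := a - 1) (E := T.P.X (t - 1)) i (by omega))
        (isZero_single_X (a := a - 1) (E := T.P.X (t - 1)) (i + 1) (by omega))).2 (hqi i hlt)
  · -- `ker(d : Q⟨ψ₀⟩ᵃ⁻² → Q⟨ψ₀⟩ᵃ⁻¹) ≅ ker(Tᵗ⁻¹ → Tᵗ)` is the image of `Tᵗ⁻²` (`T` exact at `t - 1 ≠ 0`)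
    haveI : Epi (kernel.lift (T.P.d (t - 1) t) (T.P.d (t - 1 - 1) (t - 1)) (T.P.d_comp_d _ _ _)) :=
      epi_kernelLift_d_of_exactAt T.P (t - 1 - 1) (t - 1) t (by omega) (by omega) (T.exactAt_of_ne_zero (by omega))
    haveI : Mono (e ≫ (mappingCone.inr (fromSingle ψ₀ hψ)).f (a - 1)) := by
      haveI := mono_inr_f (fromSingle ψ₀ hψ) (a - 1)
      exact mono_comp _ _
    haveI := epi_kernelLift_of_comp_mono (T.P.d_comp_d (t - 1 - 1) (t - 1) t)
      (e ≫ (mappingCone.inr (fromSingle ψ₀ hψ)).f (a - 1)) rfl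
    exact epi_kernelLift_of_iso_comp (g := T.P.d (t - 1) t ≫ e ≫ (mappingCone.inr (fromSingle ψ₀ hψ)).f (a - 1))
      (u := T.P.d (t - 1 - 1) (t - 1)) _ (inv (ιE ψ₀ hψ (a - 1 - 1) _))
      (by simp only [Category.assoc, IsIso.hom_inv_id, Category.comp_id]) (by rw [IsIso.eq_inv_comp, hd])

omit [IsLocallyNoetherian X] in
/-- **The T-phase**: after `n` steps from `TInv T 0 a₀`. [cite: Fulton1998, App. B.8.3 (iii)–(v)] [cite: Hartshorne1977, III Ex. 6.9 (a)–(b) (p. 239)] -/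
theorem tInv_iter {G : X.Modules} (T : StrictlyPerfectResolution G) {a₀ : ℤ} (ha₀ : a₀ - 1 < m) (h₀ : TInv K m π T 0 a₀) (n : ℕ) :
    TInv K m π T (-(n : ℤ)) (a₀ - n) := by
  induction n with
  | zero => simpa using h₀
  | succ n ih =>
    have e₁ : (-((n + 1 : ℕ) : ℤ)) = -(n : ℤ) - 1 := by push_cast; ring
    have e₂ : a₀ - ((n + 1 : ℕ) : ℤ) = a₀ - n - 1 := by push_cast; ring
    rw [e₁, e₂]
    exact tInv_step T (by omega) (by omega) ih

omit [IsLocallyNoetherian X] in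
/-- **End of the T-phase**: once `Tᵗ⁻¹ = 0`, the complex is a resolution of `H[-m]`. [cite: Fulton1998, App. B.8.3 (iii)–(v)] [cite: Hartshorne1977, III Ex. 6.9 (a)–(b) (p. 239)] -/
theorem quasiIso_of_tInv {G : X.Modules} (T : StrictlyPerfectResolution G) {t a : ℤ} (ham : a - 1 < m)
    (hT : IsZero (T.P.X (t - 1))) (h : TInv K m π T t a) :
    ∃ (Q : CochainComplex X.Modules ℤ) (j : K ⟶ Q) (β : Q ⟶ (single X.Modules (ComplexShape.up ℤ) m).obj H),
      IsBoundedVBComplex Q ∧ Q.IsStrictlyLE m ∧ j ≫ β = π ∧ QuasiIso β := by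
  obtain ⟨Q, j, β, hQ, hLE, hjβ, hqi, hz, e, he, hiso, hE⟩ := h
  refine ⟨Q, j, β, hQ, hLE, hjβ, (quasiIso_iff _).2 fun i ↦ ?_⟩
  rcases lt_trichotomy i (a - 1) with hlt | rfl | hgt
  · rw [quasiIsoAt_iff_exactAt' _ i (exactAt_single_obj _ _ _ _ (by omega))]
    exact (Q.exactAt_iff i).2 (ShortComplex.exact_of_isZero_X₂ _ (hz i hlt))
  · -- the kernel of `dᵃ⁻¹` receives an epimorphism from `Tᵗ⁻¹ = 0`, so `dᵃ⁻¹` is a monomorphism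
    rw [quasiIsoAt_iff_exactAt' _ (a - 1) (exactAt_single_obj _ _ _ _ (by omega)),
      Q.exactAt_iff' (a - 1 - 1) (a - 1) a (by simp only [CochainComplex.prev]) (by simp only [CochainComplex.next]; omega),
      ShortComplex.exact_iff_epi_kernel_lift]
    haveI := hE
    have hk : IsZero (kernel (Q.d (a - 1) a)) :=
      IsZero.of_epi (kernel.lift (Q.d (a - 1) a) (T.P.d (t - 1) t ≫ e) _) hT
    exact epi_of_target_iso_zero _ hk.isoZero
  · exact hqi i hgt

end TPhase

/-! ### §2 The adapted resolution -/

include hres in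
/-- **THE ADAPTED RESOLUTION.** On a locally noetherian scheme on which every coherent module has a strictly perfect resolution
(`hres`), let `K` be a bounded complex of vector bundles concentrated in degrees `≤ m`, `H` a coherent module and `π : K ⟶ H[-m]` a chain map
which is an epimorphism in degree `m`. Then there is a bounded complex `P` of vector bundles concentrated in degrees `≤ m`, a
QUASI-ISOMORPHISM `ε : P ⟶ H[-m]` (so `P`, shifted, is a strictly perfect resolution of `H`) and a CHAIN MAP `j : K ⟶ P` with `j ≫ ε = π`. [cite: Fulton1998, App. B.8.3 (iii)–(v)] [cite: Hartshorne1977, III Ex. 6.9 (a)–(b) (p. 239)] -/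
theorem exists_adaptedResolution {K : CochainComplex X.Modules ℤ} (hK : IsBoundedVBComplex K) {m : ℤ} [K.IsStrictlyLE m]
    {H : X.Modules} (hH : Coh H) (π : K ⟶ (single X.Modules (ComplexShape.up ℤ) m).obj H) (hπ : Epi (π.f m)) :
    ∃ (P : CochainComplex X.Modules ℤ) (j : K ⟶ P) (ε : P ⟶ (single X.Modules (ComplexShape.up ℤ) m).obj H),
      IsBoundedVBComplex P ∧ P.IsStrictlyLE m ∧ j ≫ ε = π ∧ QuasiIso ε := by
  obtain ⟨b, hb⟩ := hK.exists_isZero_of_gt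
  -- K-phase down to a frontier `f ≤ b - 1`, `f < m`
  obtain ⟨Q, j, β, hQ, hLE, hjβ, hqi, hiso⟩ := kInv_iter hres hK hH hπ (m - b).toNat
  set f := m - 1 - ((m - b).toNat : ℤ) with hf
  have hfm : f < m := by omega
  have hfb : f ≤ b - 1 := by omega
  have hz : ∀ i, i < f → IsZero (Q.X i) := fun i hi ↦ by
    haveI := hiso i hi
    exact (hb i (by omega)).of_iso (asIso (j.f i)).symm
  -- T-phase
  haveI := hLE
  obtain ⟨T⟩ := hres _ (coh_kernel (Q.d f (f + 1)) (coh_of_isFiniteLocallyFree (hQ.isFiniteLocallyFree f))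
    (coh_of_isFiniteLocallyFree (hQ.isFiniteLocallyFree (f + 1))))
  have h₀ := tInv_start hQ j β hjβ hfm hqi hz T
  have hn := tInv_iter T (a₀ := f) (by omega) h₀ (T.length + 1)
  exact quasiIso_of_tInv T (by push_cast; omega) (T.isZero_X_of_lt (by push_cast; omega)) hn

end Scheme

end Literature.AlgebraicGeometry.KTheory.Adapted

end
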